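import Summits.RiemannHypothesis.RiemannHypothesis.Theorems.SoninCertEta
import Summits.RiemannHypothesis.RiemannHypothesis.Theorems.SoninBandEnergyEntry
import Literature.Analysis.FunctionSpaces.PlancherelL1L2
import HarnessLib

/-!
# Sonin-section certificate for `S = {∞, 2}`, P3: the band energy of `η` — `∫_{[−1,1]} |𝓕η|² ≤ epsQ = 3·10⁻¹²`

Cell `rh-explicit`, seat cc-s2-3, Phase 2 (lead R7-12/R7-12a), file P3: hypothesis `hε` of cc-s2-1's bridge / assembly
(`not_semilocalSoninIneqOn_two_of_eta_certificates`).  `η = R(|x|)·1_{1≤|x|≤8}` (`SoninCertEta.etaFun`, class `eta`).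
Route (pointwise Taylor in `ξ`, as in E1's `SoninBandEnergyEntry` but for ONE function on `[−8, 8]`):
`𝓕η(ξ) = ∫_{[−8,8]} e^{−2πixξ} η(x) dx = Σ_{k<230} ((−2πiξ)^k/k!) m_k + ρ(ξ)`, `m_k = ∫ x^k η = (1 + (−1)^k)∫₁⁸ x^k R`
(`mom18`, exact rationals), `|ρ| ≤ 2(16π)^{230}/230! · ∫|η| ≤ rhoQ` (`Complex.exp_bound'`, `|2πxξ| ≤ 16π ≤ 52 ≤ 231/2`);
the main term is the REAL even polynomial `T(ξ) = ev etaTaylorL ((πξ)²)`; `|𝓕η|² ≤ (11/10)T² + 11 rhoQ²`;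
`∫_{−1}^{1} T² = ev (yT2 (etaTaylorL·etaTaylorL)) (π²)` (E1's `integral_ev_sq`), enclosed by E1's interval Horner
`hornerMI` at `π²/16` (scale `2^192`, the engine's Machin `π`); the kernel check `checkEps` closes
`(11/10)·∫T² + 22 rhoQ² ≤ epsQ` (value `∫T² = 1.9134992…·10⁻¹²`).  The `L²`-class statement follows by the tree's
`L¹ ∩ L²` consistency `fourier_toLp_ae_eq_fourierIntegral`.  Definitions: `mom18`, `etaTaylorL`, `rhoQ`, `epsScale`,
`piSq16E`, `checkEps` (certificate bookkeeping).  No facts, no axioms; nothing about `ζ`.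
-/

set_option linter.dupNamespace false  -- the mandated namespace repeats `RiemannHypothesis`

noncomputable section

open MeasureTheory Complex Set Finset
open scoped Real FourierTransform
open Summit.RiemannHypothesis.RiemannHypothesis.Theorems.SemilocalPolyWitness
open Summit.RiemannHypothesis.RiemannHypothesis.Theorems.MotivicDoor
open Summit.RiemannHypothesis.RiemannHypothesis.BandEnergy
open Literature.Analysis.ValidatedNumerics Literature.Analysis.ValidatedNumerics.NumericsMP

namespace Summit.RiemannHypothesis.RiemannHypothesis.SoninCert

/-! ## Moments of `η` -/

/-- `mom18 l k = ∫₁⁸ x^k l(x) dx` (kernel-computable recursion). [folklore] -/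
def mom18 : List ℚ → ℕ → ℚ
  | [], _ => 0
  | a :: as, k => a * ((8 ^ (k + 1) - 1) / (k + 1)) + mom18 as (k + 1)

/-- `mom18 l k = ∫₁⁸ x^k l(x) dx`. [folklore] -/
theorem mom18_eq_integral : ∀ (l : List ℚ) (k : ℕ), ((mom18 l k : ℚ) : ℝ) = ∫ x in (1 : ℝ)..8, x ^ k * LQ.ev l x
  | [], k => by simp [mom18]
  | a :: as, k => by
      have ih := mom18_eq_integral as (k + 1)
      have h1 : (fun x : ℝ => x ^ k * LQ.ev (a :: as) x) = fun x : ℝ => (a : ℝ) * x ^ k + x ^ (k + 1) * LQ.ev as x := by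
        funext x; rw [LQ.ev_cons]; ring
      have i1 : IntervalIntegrable (fun x : ℝ => (a : ℝ) * x ^ k) volume (1 : ℝ) 8 :=
        (continuous_const.mul (continuous_pow k)).intervalIntegrable _ _
      have i2 : IntervalIntegrable (fun x : ℝ => x ^ (k + 1) * LQ.ev as x) volume (1 : ℝ) 8 :=
        ((continuous_pow (k + 1)).mul (LQ.continuous_ev as)).intervalIntegrable _ _
      rw [h1, intervalIntegral.integral_add i1 i2, ← ih, intervalIntegral.integral_const_mul, integral_pow, mom18]
      push_cast
      rw [one_pow]

/-- **The moments of `η`**: `∫_{[−8,8]} x^k η(x) dx = (1 + (−1)^k) ∫₁⁸ x^k R(x) dx`. [folklore] -/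
theorem setIntegral_pow_mul_etaFun (k : ℕ) :
    ∫ x in Icc (-8 : ℝ) 8, (x : ℂ) ^ k * etaFun x = ((((1 + (-1) ^ k) * mom18 rL k : ℚ) : ℝ) : ℂ) := by
  rw [setIntegral_eq_integral_of_forall_compl_eq_zero (fun x hx => by rw [etaFun_eq_zero_of_not_mem hx, mul_zero])]
  have hsplit : (fun x : ℝ => (x : ℂ) ^ k * etaFun x)
      = (Icc (1 : ℝ) 8).indicator (fun x => (((x ^ k * LQ.ev rL x : ℝ)) : ℂ))
        + (Icc (-8 : ℝ) (-1)).indicator (fun x => (((x ^ k * LQ.ev rL (-x) : ℝ)) : ℂ)) := by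
    funext x
    simp only [Pi.add_apply]
    by_cases h1 : x ∈ Icc (1 : ℝ) 8
    · have h2 : x ∉ Icc (-8 : ℝ) (-1) := fun h => by linarith [h.2, h1.1]
      rw [indicator_of_mem h1, indicator_of_notMem h2, add_zero, etaFun_of_mem h1]; push_cast; ring
    · by_cases h2 : x ∈ Icc (-8 : ℝ) (-1)
      · have h1' : -x ∈ Icc (1 : ℝ) 8 := ⟨by linarith [h2.2], by linarith [h2.1]⟩
        rw [indicator_of_notMem h1, indicator_of_mem h2, zero_add, ← etaFun_neg, etaFun_of_mem h1']; push_cast; ring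
      · have hz : etaFun x = 0 := by
          by_cases h8 : x ∈ Icc (-8 : ℝ) 8
          · refine etaFun_eq_zero_of_abs_lt (abs_lt.2 ⟨?_, ?_⟩)
            · by_contra h; exact h2 ⟨h8.1, by linarith⟩
            · by_contra h; exact h1 ⟨by linarith, h8.2⟩
          · exact etaFun_eq_zero_of_not_mem h8
        rw [indicator_of_notMem h1, indicator_of_notMem h2, add_zero, hz, mul_zero]
  have hc1 : Continuous fun x : ℝ => (((x ^ k * LQ.ev rL x : ℝ)) : ℂ) :=
    Complex.continuous_ofReal.comp ((continuous_pow k).mul (LQ.continuous_ev _))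
  have hc2 : Continuous fun x : ℝ => (((x ^ k * LQ.ev rL (-x) : ℝ)) : ℂ) :=
    Complex.continuous_ofReal.comp ((continuous_pow k).mul ((LQ.continuous_ev _).comp continuous_neg))
  rw [hsplit, integral_add' (hc1.integrableOn_Icc.integrable_indicator measurableSet_Icc)
    (hc2.integrableOn_Icc.integrable_indicator measurableSet_Icc), integral_indicator measurableSet_Icc,
    integral_indicator measurableSet_Icc, integral_complex_ofReal, integral_complex_ofReal,
    integral_Icc_eq_integral_Ioc, ← intervalIntegral.integral_of_le (by norm_num : (1 : ℝ) ≤ 8),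
    integral_Icc_eq_integral_Ioc, ← intervalIntegral.integral_of_le (by norm_num : (-8 : ℝ) ≤ -1),
    ← mom18_eq_integral]
  have hneg : ∫ x in (-8 : ℝ)..(-1), x ^ k * LQ.ev rL (-x) = (-1) ^ k * ∫ x in (1 : ℝ)..8, x ^ k * LQ.ev rL x := by
    have h := intervalIntegral.integral_comp_neg (a := (-8 : ℝ)) (b := -1) (fun y => (-y) ^ k * LQ.ev rL y)
    simp only [neg_neg] at h
    rw [h, ← intervalIntegral.integral_const_mul]
    refine intervalIntegral.integral_congr fun x _ => ?_
    simp only [neg_pow x k]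
    ring
  rw [hneg, ← mom18_eq_integral]
  push_cast; ring

/-! ## The Taylor step on `[−8, 8]` -/

/-- **Taylor step** (E1's `norm_setIntegral_fourierKernel_sub_taylor_le` on `[−8, 8]`): for `g ∈ L¹[−8,8]`, `|ξ| ≤ 1`
and `n ≥ 103`, `‖∫ e^{−2πixξ} g − Σ_{k<n} ((−2πiξ)^k/k!) ∫ x^k g‖ ≤ 2(16π)^n/n! · ∫‖g‖`. [folklore] -/
theorem norm_setIntegral_fourierKernel_sub_taylor_le8 {g : ℝ → ℂ} (hg : IntegrableOn g (Icc (-8 : ℝ) 8))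
    {ξ : ℝ} (hξ : |ξ| ≤ 1) {n : ℕ} (hn : 103 ≤ n) :
    ‖(∫ x in Icc (-8 : ℝ) 8, cexp (↑(-2 * π * x * ξ) * I) * g x)
        - ∑ k ∈ range n, (↑(-2 * π * ξ) * I) ^ k / (k.factorial : ℂ)
            * ∫ x in Icc (-8 : ℝ) 8, (x : ℂ) ^ k * g x‖
      ≤ 2 * (16 * π) ^ n / n.factorial * ∫ x in Icc (-8 : ℝ) 8, ‖g x‖ := by
  set z : ℂ := ↑(-2 * π * ξ) * I with hz
  have hzn : ‖z‖ ≤ 2 * π := by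
    rw [hz, norm_mul, Complex.norm_I, mul_one, Complex.norm_real, Real.norm_eq_abs]
    rw [show -2 * π * ξ = -(2 * π * ξ) by ring, abs_neg, abs_mul, abs_of_pos Real.two_pi_pos]
    nlinarith [Real.pi_pos]
  have hIk : ∀ k : ℕ, IntegrableOn (fun x : ℝ => (x : ℂ) ^ k * g x) (Icc (-8 : ℝ) 8) := fun k =>
    IntegrableOn.continuousOn_mul (by fun_prop) hg isCompact_Icc
  have hIe : IntegrableOn (fun x : ℝ => cexp (↑(-2 * π * x * ξ) * I) * g x) (Icc (-8 : ℝ) 8) :=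
    IntegrableOn.continuousOn_mul (by fun_prop) hg isCompact_Icc
  have hIs : IntegrableOn (fun x : ℝ => (∑ k ∈ range n, ((x : ℂ) * z) ^ k / (k.factorial : ℂ)) * g x)
      (Icc (-8 : ℝ) 8) :=
    IntegrableOn.continuousOn_mul (by fun_prop) hg isCompact_Icc
  have hsum : ∑ k ∈ range n, z ^ k / (k.factorial : ℂ) * ∫ x in Icc (-8 : ℝ) 8, (x : ℂ) ^ k * g x
      = ∫ x in Icc (-8 : ℝ) 8, (∑ k ∈ range n, ((x : ℂ) * z) ^ k / (k.factorial : ℂ)) * g x := by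
    have hc : ∀ k ∈ range n, z ^ k / (k.factorial : ℂ) * ∫ x in Icc (-8 : ℝ) 8, (x : ℂ) ^ k * g x
        = ∫ x in Icc (-8 : ℝ) 8, z ^ k / (k.factorial : ℂ) * ((x : ℂ) ^ k * g x) :=
      fun k _ => (integral_const_mul _ _).symm
    rw [Finset.sum_congr rfl hc, ← integral_finsetSum _ fun k _ => (hIk k).const_mul (z ^ k / (k.factorial : ℂ))]
    refine integral_congr_ae (Filter.Eventually.of_forall fun x => ?_)
    simp only
    rw [Finset.sum_mul]
    exact Finset.sum_congr rfl fun k _ => by rw [mul_pow]; ring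
  have hexp : ∀ x : ℝ, cexp (↑(-2 * π * x * ξ) * I) = cexp ((x : ℂ) * z) := fun x => by
    rw [hz]; congr 1; push_cast; ring
  rw [hsum, ← integral_sub hIe hIs]
  have hpt : ∀ x ∈ Icc (-8 : ℝ) 8,
      ‖cexp (↑(-2 * π * x * ξ) * I) * g x - (∑ k ∈ range n, ((x : ℂ) * z) ^ k / (k.factorial : ℂ)) * g x‖
        ≤ 2 * (16 * π) ^ n / n.factorial * ‖g x‖ := by
    intro x hx
    have hx1 : |x| ≤ 8 := abs_le.2 ⟨by linarith [hx.1], hx.2⟩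
    have hxz : ‖(x : ℂ) * z‖ ≤ 16 * π := by
      rw [norm_mul, Complex.norm_real, Real.norm_eq_abs]
      calc |x| * ‖z‖ ≤ 8 * (2 * π) := by gcongr
        _ = 16 * π := by ring
    have hcond : ‖(x : ℂ) * z‖ / (n.succ : ℕ) ≤ 1 / 2 := by
      rw [div_le_iff₀ (by positivity)]
      have h104 : (104 : ℝ) ≤ (n.succ : ℕ) := by
        have : (104 : ℝ) ≤ (n : ℝ) + 1 := by exact_mod_cast Nat.succ_le_succ hn
        simpa using this
      linarith [two_pi_le]
    have hb := Complex.exp_bound' (x := (x : ℂ) * z) (n := n) hcond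
    rw [hexp x, ← sub_mul, norm_mul]
    calc ‖cexp ((x : ℂ) * z) - ∑ k ∈ range n, ((x : ℂ) * z) ^ k / (k.factorial : ℂ)‖ * ‖g x‖
        ≤ ‖(x : ℂ) * z‖ ^ n / n.factorial * 2 * ‖g x‖ := by gcongr
      _ ≤ (16 * π) ^ n / n.factorial * 2 * ‖g x‖ := by gcongr
      _ = 2 * (16 * π) ^ n / n.factorial * ‖g x‖ := by ring
  calc ‖∫ x in Icc (-8 : ℝ) 8, (cexp (↑(-2 * π * x * ξ) * I) * g x
          - (∑ k ∈ range n, ((x : ℂ) * z) ^ k / (k.factorial : ℂ)) * g x)‖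
      ≤ ∫ x in Icc (-8 : ℝ) 8, ‖cexp (↑(-2 * π * x * ξ) * I) * g x
          - (∑ k ∈ range n, ((x : ℂ) * z) ^ k / (k.factorial : ℂ)) * g x‖ :=
        norm_integral_le_integral_norm _
    _ ≤ ∫ x in Icc (-8 : ℝ) 8, 2 * (16 * π) ^ n / n.factorial * ‖g x‖ :=
        setIntegral_mono_on (hIe.sub hIs).norm (hg.norm.const_mul _) measurableSet_Icc hpt
    _ = 2 * (16 * π) ^ n / n.factorial * ∫ x in Icc (-8 : ℝ) 8, ‖g x‖ := integral_const_mul _ _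

/-! ## The certificate data and the kernel check -/

/-- The compressed (even) Taylor coefficients of `𝓕η` in `u = (πξ)²`: `c_j = (−4)^j · 2∫₁⁸x^{2j}R / (2j)!`, `j < 115`.
[folklore] -/
def etaTaylorL : List ℚ := (List.range 115).map fun j => (-4) ^ j * (2 * mom18 rL (2 * j)) / (2 * j).factorial

/-- Rational bound of the Taylor remainder: `2(16·3.1416)^{230}/230! · (16 · absBound rL 8) ≥ |ρ(ξ)|`. [folklore] -/
def rhoQ : ℚ := 2 * (16 * (31416 / 10000 : ℚ)) ^ 230 / (230).factorial * (16 * LQ.absBound rL 8)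

/-- Fixed-point scale `2^192` of the interval evaluation. [folklore] -/
def epsScale : ℕ := 6277101735386680763835789423207666416102355444464034512896

/-- The engine's enclosure of `π²/16` (Machin `π`, 48 terms). [folklore] -/
def piSq16E : Option MI := (MI.pi epsScale 48).map fun P => (MI.sqr epsScale P).divNat 16

/-- **The check**: with `H ∋ ∫_{−1}^{1} T²` (interval Horner of `yT2 (etaTaylorL²)` at `π²/16`),
`(11/10)·H.hi + 22·rhoQ²·S ≤ epsQ·S`. [folklore] -/
def checkEps : Bool :=
  match piSq16E with
  | none => false
  | some U =>
    let H := hornerMI epsScale (scaleList (yT2 (LQ.mul etaTaylorL etaTaylorL)) 16) U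
    decide ((11 / 10 : ℚ) * H.hi + 22 * rhoQ ^ 2 * epsScale ≤ epsQ * epsScale)

set_option maxHeartbeats 0 in  -- kernel evaluation of the rational certificate; no search
/-- **The check passes.** [folklore] -/
theorem checkEps_eq_true : checkEps = true := by
  decide +kernel

/-! ## Soundness -/

/-- `0 < epsScale`. [folklore] -/
theorem epsScale_pos : 0 < epsScale := by unfold epsScale; norm_num

/-- The main term as a sum: `ev etaTaylorL u = Σ_{j<115} c_j u^j`. [folklore] -/
theorem ev_etaTaylorL (u : ℝ) : LQ.ev etaTaylorL u
    = ∑ j ∈ range 115, (((-4) ^ j * (2 * mom18 rL (2 * j)) / (2 * j).factorial : ℚ) : ℝ) * u ^ j := by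
  rw [LQ.ev_eq_sum, show etaTaylorL.length = 115 by simp [etaTaylorL]]
  refine Finset.sum_congr rfl fun j hj => ?_
  rw [etaTaylorL, getD_map_range _ (Finset.mem_range.1 hj)]

/-- **The Taylor main term is real and even**: `Σ_{k<230} ((−2πiξ)^k/k!)·m_k = ev etaTaylorL ((πξ)²)`. [folklore] -/
theorem taylorSum_eq_ev (ξ : ℝ) :
    ∑ k ∈ range 230, (↑(-2 * π * ξ) * I) ^ k / (k.factorial : ℂ) * ((((1 + (-1) ^ k) * mom18 rL k : ℚ) : ℝ) : ℂ)
      = (LQ.ev etaTaylorL ((π * ξ) ^ 2) : ℂ) := by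
  have hw : ∀ k : ℕ, ((↑(-2 * π * ξ) * I : ℂ)) ^ k = (-2 * ((π * ξ : ℝ) : ℂ) * I) ^ k := fun k => by
    push_cast; ring
  have key : ∀ N : ℕ, ∑ k ∈ range (2 * N), (↑(-2 * π * ξ) * I) ^ k / (k.factorial : ℂ)
      * ((((1 + (-1) ^ k) * mom18 rL k : ℚ) : ℝ) : ℂ)
      = ((∑ j ∈ range N, ((((-4) ^ j * (2 * mom18 rL (2 * j)) / (2 * j).factorial : ℚ) : ℝ)
          * ((π * ξ) ^ 2) ^ j) : ℝ) : ℂ) := by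
    intro N
    induction N with
    | zero => simp
    | succ N ih =>
        rw [show 2 * (N + 1) = 2 * N + 1 + 1 by ring, Finset.sum_range_succ, Finset.sum_range_succ, ih,
          Finset.sum_range_succ, hw, hw, neg_two_mul_I_pow_even, neg_two_mul_I_pow_odd]
        push_cast
        have h1 : ((-1 : ℂ)) ^ (2 * N) = 1 := by rw [pow_mul]; norm_num
        have h2 : ((-1 : ℂ)) ^ (2 * N + 1) = -1 := by rw [pow_succ, h1]; norm_num
        have h3 : ((2 : ℂ)) ^ (2 * N) = 4 ^ N := by rw [pow_mul]; norm_num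
        have h4 : ((-4 : ℂ)) ^ N = (-1) ^ N * 4 ^ N := neg_pow 4 N
        rw [h1, h2, h3, h4]
        ring
  rw [key 115, ev_etaTaylorL]

/-- `η ∈ L¹(ℝ)`. [folklore] -/
theorem integrable_etaFun : Integrable etaFun :=
  SemilocalMarkov.integrable_of_norm_le_of_eq_zero (C := (LQ.absBound rL 8 : ℝ)) (R := 8)
    measurable_etaFun.aestronglyMeasurable
    (fun x => by
      by_cases hx : x ∈ Icc (-8 : ℝ) 8
      · rw [etaFun, indicator_of_mem hx]; exact norm_etaCore_le hx
      · rw [etaFun_eq_zero_of_not_mem hx, norm_zero]; exact_mod_cast LQ.absBound_nonneg rL (by norm_num))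
    (fun x hx => etaFun_eq_zero_of_not_mem fun h => by
      have := abs_le.2 ⟨by linarith [h.1], h.2⟩; linarith)

/-- `∫_{[−8,8]} ‖η‖ ≤ 16 · absBound rL 8`. [folklore] -/
theorem setIntegral_norm_etaFun_le : ∫ x in Icc (-8 : ℝ) 8, ‖etaFun x‖ ≤ 16 * (LQ.absBound rL 8 : ℝ) := by
  have hb : ∀ x ∈ Icc (-8 : ℝ) 8, ‖etaFun x‖ ≤ (LQ.absBound rL 8 : ℝ) := fun x hx => by
    rw [etaFun, indicator_of_mem hx]; exact norm_etaCore_le hx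
  calc ∫ x in Icc (-8 : ℝ) 8, ‖etaFun x‖ ≤ ∫ x in Icc (-8 : ℝ) 8, (LQ.absBound rL 8 : ℝ) :=
        setIntegral_mono_on integrable_etaFun.norm.integrableOn (by simp) measurableSet_Icc hb
    _ = 16 * (LQ.absBound rL 8 : ℝ) := by
        rw [setIntegral_const, smul_eq_mul, Measure.real, Real.volume_Icc]; norm_num

/-- `𝓕η(ξ) = ∫_{[−8,8]} e^{−2πixξ} η(x) dx`. [folklore] -/
theorem fourier_etaFun_eq (ξ : ℝ) :
    𝓕 etaFun ξ = ∫ x in Icc (-8 : ℝ) 8, cexp (↑(-2 * π * x * ξ) * I) * etaFun x := by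
  rw [Real.fourier_real_eq_integral_exp_smul]
  simp only [smul_eq_mul]
  exact (setIntegral_eq_integral_of_forall_compl_eq_zero fun x hx => by
    rw [etaFun_eq_zero_of_not_mem hx, mul_zero]).symm

/-- **Pointwise remainder bound**: `‖𝓕η(ξ) − T(ξ)‖ ≤ rhoQ` for `|ξ| ≤ 1`. [folklore] -/
theorem norm_fourier_etaFun_sub_le {ξ : ℝ} (hξ : |ξ| ≤ 1) :
    ‖𝓕 etaFun ξ - (LQ.ev etaTaylorL ((π * ξ) ^ 2) : ℂ)‖ ≤ (rhoQ : ℝ) := by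
  have ht := norm_setIntegral_fourierKernel_sub_taylor_le8 integrable_etaFun.integrableOn hξ
    (show 103 ≤ 230 by norm_num)
  simp_rw [setIntegral_pow_mul_etaFun] at ht
  rw [taylorSum_eq_ev, ← fourier_etaFun_eq] at ht
  refine ht.trans ?_
  have hπ : π ≤ 31416 / 10000 := by have := Real.pi_lt_d4; norm_num at this ⊢; linarith
  have h1 : 2 * (16 * π) ^ 230 / (Nat.factorial 230 : ℝ) ≤ ((2 * (16 * (31416 / 10000 : ℚ)) ^ 230 / (230).factorial : ℚ) : ℝ) := by
    push_cast; gcongr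
  have h0 : (0 : ℝ) ≤ ∫ x in Icc (-8 : ℝ) 8, ‖etaFun x‖ := integral_nonneg fun _ => norm_nonneg _
  rw [rhoQ]
  push_cast at h1 ⊢
  calc 2 * (16 * π) ^ 230 / (Nat.factorial 230 : ℝ) * ∫ x in Icc (-8 : ℝ) 8, ‖etaFun x‖
      ≤ (2 * (16 * (31416 / 10000 : ℝ)) ^ 230 / (Nat.factorial 230 : ℝ)) * ∫ x in Icc (-8 : ℝ) 8, ‖etaFun x‖ :=
        mul_le_mul_of_nonneg_right h1 h0
    _ ≤ (2 * (16 * (31416 / 10000 : ℝ)) ^ 230 / (Nat.factorial 230 : ℝ)) * (16 * (LQ.absBound rL 8 : ℝ)) :=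
        mul_le_mul_of_nonneg_left setIntegral_norm_etaFun_le (by positivity)

/-- **Pointwise energy bound**: `‖𝓕η(ξ)‖² ≤ (11/10)·T(ξ)² + 11·rhoQ²` for `|ξ| ≤ 1`. [folklore] -/
theorem norm_sq_fourier_etaFun_le {ξ : ℝ} (hξ : |ξ| ≤ 1) :
    ‖𝓕 etaFun ξ‖ ^ 2 ≤ (11 / 10) * (LQ.ev etaTaylorL ((π * ξ) ^ 2)) ^ 2 + 11 * (rhoQ : ℝ) ^ 2 := by
  set T : ℝ := LQ.ev etaTaylorL ((π * ξ) ^ 2)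
  have h1 : ‖𝓕 etaFun ξ‖ ≤ |T| + rhoQ := by
    have h := norm_fourier_etaFun_sub_le hξ
    have := norm_le_norm_add_norm_sub' (𝓕 etaFun ξ) (T : ℂ)
    rw [Complex.norm_real, Real.norm_eq_abs] at this
    linarith
  have h0 : 0 ≤ |T| + rhoQ := (norm_nonneg _).trans h1
  calc ‖𝓕 etaFun ξ‖ ^ 2 ≤ (|T| + rhoQ) ^ 2 := pow_le_pow_left₀ (norm_nonneg _) h1 2
    _ ≤ (11 / 10) * T ^ 2 + 11 * (rhoQ : ℝ) ^ 2 := by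
        rw [← sq_abs T]; nlinarith [sq_nonneg (|T| - 10 * rhoQ), sq_abs T]

/-- **The band energy of `η` (function form)**: `∫_{[−1,1]} ‖𝓕η‖² ≤ (11/10)·(yT2 (T·T))(π²) + 22·rhoQ²`. [folklore] -/
theorem integral_norm_sq_fourier_etaFun_le :
    ∫ ξ in Icc (-1 : ℝ) 1, ‖𝓕 etaFun ξ‖ ^ 2
      ≤ (11 / 10) * LQ.ev (yT2 (LQ.mul etaTaylorL etaTaylorL)) (π ^ 2) + 22 * (rhoQ : ℝ) ^ 2 := by
  have hcF : Continuous fun ξ : ℝ => 𝓕 etaFun ξ :=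
    VectorFourier.fourierIntegral_continuous Real.continuous_fourierChar (by fun_prop) integrable_etaFun
  have hcT : Continuous fun ξ : ℝ => (11 / 10) * (LQ.ev etaTaylorL ((π * ξ) ^ 2)) ^ 2 + 11 * (rhoQ : ℝ) ^ 2 := by
    have := LQ.continuous_ev etaTaylorL; fun_prop
  calc ∫ ξ in Icc (-1 : ℝ) 1, ‖𝓕 etaFun ξ‖ ^ 2
      ≤ ∫ ξ in Icc (-1 : ℝ) 1, ((11 / 10) * (LQ.ev etaTaylorL ((π * ξ) ^ 2)) ^ 2 + 11 * (rhoQ : ℝ) ^ 2) :=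
        setIntegral_mono_on ((hcF.norm.pow 2).integrableOn_Icc) hcT.integrableOn_Icc measurableSet_Icc
          fun ξ hξ => norm_sq_fourier_etaFun_le (abs_le.2 ⟨by linarith [hξ.1], hξ.2⟩)
    _ = (11 / 10) * LQ.ev (yT2 (LQ.mul etaTaylorL etaTaylorL)) (π ^ 2) + 22 * (rhoQ : ℝ) ^ 2 := by
        have i1 : IntervalIntegrable (fun ξ : ℝ => (11 / 10 : ℝ) * (LQ.ev etaTaylorL ((π * ξ) ^ 2)) ^ 2) volume (-1) 1 :=
          (by have := LQ.continuous_ev etaTaylorL; fun_prop :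
            Continuous fun ξ : ℝ => (11 / 10 : ℝ) * (LQ.ev etaTaylorL ((π * ξ) ^ 2)) ^ 2).intervalIntegrable _ _
        have i2 : IntervalIntegrable (fun _ : ℝ => 11 * (rhoQ : ℝ) ^ 2) volume (-1) 1 := intervalIntegrable_const
        rw [integral_Icc_eq_integral_Ioc, ← intervalIntegral.integral_of_le (by norm_num : (-1 : ℝ) ≤ 1),
          intervalIntegral.integral_add i1 i2, intervalIntegral.integral_const_mul,
          intervalIntegral.integral_const]
        have e : (fun ξ : ℝ => (LQ.ev etaTaylorL ((π * ξ) ^ 2)) ^ 2)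
            = fun ξ => LQ.ev (LQ.mul etaTaylorL etaTaylorL) ((π * ξ) ^ 2) := by
          funext ξ; rw [LQ.ev_mul, sq]
        rw [e, integral_ev_sq]
        norm_num; ring

/-- The enclosure of `π²/16` behind `checkEps`, with its membership. [folklore] -/
theorem piSq16E_mem : ∃ U, piSq16E = some U ∧ MI.mem epsScale (π ^ 2 / 16) U := by
  have h := checkEps_eq_true
  unfold checkEps at h
  cases hU : piSq16E with
  | none => rw [hU] at h; exact absurd h (by simp)
  | some U =>
    refine ⟨U, rfl, ?_⟩
    obtain ⟨P, hP, rfl⟩ := Option.map_eq_some_iff.1 hU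
    have h2 := MI.mem_divNat (MI.mem_sqr epsScale_pos (MI.mem_pi epsScale hP)) (n := 16) (by norm_num)
    convert h2 using 2
    norm_num

/-- **THE BAND ENERGY OF `η` (function form) IS AT MOST `epsQ`.** [folklore] -/
theorem integral_norm_sq_fourier_etaFun_le_epsQ :
    ∫ ξ in Icc (-1 : ℝ) 1, ‖𝓕 etaFun ξ‖ ^ 2 ≤ ((epsQ : ℚ) : ℝ) := by
  obtain ⟨U, hU, hmem⟩ := piSq16E_mem
  have h := checkEps_eq_true
  unfold checkEps at h
  rw [hU] at h
  simp only [decide_eq_true_eq] at h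
  set H := hornerMI epsScale (scaleList (yT2 (LQ.mul etaTaylorL etaTaylorL)) 16) U with hH
  have hS : (0 : ℝ) < epsScale := by exact_mod_cast epsScale_pos
  have hev : LQ.ev (yT2 (LQ.mul etaTaylorL etaTaylorL)) (π ^ 2) ≤ (H.hi : ℝ) / epsScale := by
    have := le_hi_of_mem_hornerMI epsScale_pos hmem (scaleList (yT2 (LQ.mul etaTaylorL etaTaylorL)) 16)
    rw [ev_scaleList] at this
    push_cast at this
    rw [show (16 : ℝ) * (π ^ 2 / 16) = π ^ 2 by ring] at this
    exact this
  have h' : (11 / 10 : ℝ) * (H.hi : ℝ) + 22 * (rhoQ : ℝ) ^ 2 * epsScale ≤ (epsQ : ℝ) * epsScale := by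
    have h1 := (Rat.cast_le (K := ℝ)).2 h
    push_cast at h1
    exact h1
  refine integral_norm_sq_fourier_etaFun_le.trans ?_
  rw [le_div_iff₀ hS] at hev
  have : ((11 / 10) * LQ.ev (yT2 (LQ.mul etaTaylorL etaTaylorL)) (π ^ 2) + 22 * (rhoQ : ℝ) ^ 2) * epsScale
      ≤ (epsQ : ℝ) * epsScale := by nlinarith
  exact le_of_mul_le_mul_right this hS

/-- **`hε` OF THE BRIDGE**: the `L²` Fourier transform of the class `eta` has band energy at most `epsQ = 3·10⁻¹²`
on `[−1, 1]`. [folklore] -/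
theorem integral_norm_sq_lpFourier_eta_le :
    ∫ x in Icc (-1 : ℝ) 1, ‖((𝓕 eta : Lp ℂ 2 (volume : Measure ℝ)) : ℝ → ℂ) x‖ ^ 2 ≤ ((epsQ : ℚ) : ℝ) := by
  have hae := Literature.Analysis.FunctionSpaces.fourier_toLp_ae_eq_fourierIntegral integrable_etaFun memLp_etaFun
  have hI : ∫ x in Icc (-1 : ℝ) 1, ‖((𝓕 eta : Lp ℂ 2 (volume : Measure ℝ)) : ℝ → ℂ) x‖ ^ 2
      = ∫ ξ in Icc (-1 : ℝ) 1, ‖𝓕 etaFun ξ‖ ^ 2 :=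
    integral_congr_ae (ae_restrict_of_ae (hae.mono fun ξ hξ => by simp only [eta, hξ]))
  rw [hI]
  exact integral_norm_sq_fourier_etaFun_le_epsQ

end Summit.RiemannHypothesis.RiemannHypothesis.SoninCert
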